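import Mathlib.Analysis.Calculus.MeanValue
import Mathlib.MeasureTheory.Integral.ExpDecay
import Literature.NumberTheory.LFunctions.WeilMarkovQuadratic
import HarnessLib

/-!
# Stub `stub_dirichletEnergy_mul` of the line `Sketch` (crux `WeilGroundState.GroundStatesConvergeToXi`,
item stmt-RiemannHypothesis-1527, rev L9)

**Bounded smooth multipliers act boundedly on the pure-jump Dirichlet form of a window.**
For every `a > 0` there is `K = K(a) ≥ 0` such that for test functions `w`, `g` with `‖w‖ ≤ W`,
`‖w'‖ ≤ L`,

  `𝓔_a(w g) ≤ 2 W² 𝓔_a(g) + K (W² + L²) ‖g‖₂²`,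

`𝓔_a = weilDirichletEnergy a` (`Literature/NumberTheory/LFunctions/WeilMarkovQuadratic.lean`).

Proof outline.
1. Pointwise `w(x+t)g(x+t) − w(x)g(x) = w(x+t)(g(x+t) − g(x)) + (w(x+t) − w(x)) g(x)`, so
   `|…|² ≤ 2 W² |g(x+t) − g(x)|² + 2 |w(x+t) − w(x)|² |g(x)|²`; integrating in `x`, for any bound
   `|w(x+t) − w(x)|² ≤ B` one gets `D_t(w g) ≤ 2 W² D_t(g) + 2 B ‖g‖₂²`
   (`dirichletMul_weilIncrement_le`).
2. `|w(x+t) − w(x)| ≤ min (L t) (2 W)` (mean value inequality,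
   `Convex.norm_image_sub_le_of_norm_deriv_le`), hence `|w(x+t) − w(x)|² ≤ 4 W²` (used at the
   finitely many prime-power lengths `log n`, `n ∈ weilPrimeIndex a`) and
   `|w(x+t) − w(x)|² ≤ 2 L W t ≤ (W² + L²) t` for `t ≥ 0` (used in the archimedean integral).
3. The archimedean density satisfies `t e^{t/2}/(2 sinh t) ≤ 4 e^{-t/4}` (`t > 0`), so
   `A = ∫₀^∞ t e^{t/2}/(2 sinh t) dt < ∞`; with `S = Σ_{n ∈ weilPrimeIndex a} Λ(n)/√n` one gets
   `𝓔_a(w g) ≤ 2 W² 𝓔_a(g) + (8 W² S + 2 (W² + L²) A) ‖g‖₂²`, and `K = 8 S + 2 A` works.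
-/

set_option linter.dupNamespace false

noncomputable section

open MeasureTheory Complex Filter Set
open scoped Real Topology ComplexConjugate ArithmeticFunction.vonMangoldt

namespace Summit.RiemannHypothesis.RiemannHypothesis.Theorems.GroundStatesConvergeToXi

open Literature.NumberTheory.LFunctions

/-! ## Pointwise bounds -/

/-- The product rule for increments, squared: if `‖w‖ ≤ W` then
`‖w(x+t) g(x+t) − w(x) g(x)‖² ≤ 2 W² ‖g(x+t) − g(x)‖² + 2 ‖w(x+t) − w(x)‖² ‖g(x)‖²`. [folklore] -/
theorem dirichletMul_norm_sub_sq_le {w g : ℝ → ℂ} {W : ℝ} (hW : ∀ x, ‖w x‖ ≤ W) (x t : ℝ) :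
    ‖w (x + t) * g (x + t) - w x * g x‖ ^ 2 ≤
      2 * W ^ 2 * ‖g (x + t) - g x‖ ^ 2 + 2 * ‖w (x + t) - w x‖ ^ 2 * ‖g x‖ ^ 2 := by
  have hW0 : 0 ≤ W := (norm_nonneg _).trans (hW 0)
  have h1 : ‖w (x + t) * g (x + t) - w x * g x‖ ≤
      W * ‖g (x + t) - g x‖ + ‖w (x + t) - w x‖ * ‖g x‖ := by
    have e : w (x + t) * g (x + t) - w x * g x =
        w (x + t) * (g (x + t) - g x) + (w (x + t) - w x) * g x := by ring
    rw [e]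
    refine (norm_add_le _ _).trans (add_le_add ?_ ?_)
    · rw [norm_mul]
      exact mul_le_mul_of_nonneg_right (hW _) (norm_nonneg _)
    · rw [norm_mul]
  have hA : 0 ≤ W * ‖g (x + t) - g x‖ := by positivity
  have hB : 0 ≤ ‖w (x + t) - w x‖ * ‖g x‖ := by positivity
  calc ‖w (x + t) * g (x + t) - w x * g x‖ ^ 2
      ≤ (W * ‖g (x + t) - g x‖ + ‖w (x + t) - w x‖ * ‖g x‖) ^ 2 :=
        pow_le_pow_left₀ (norm_nonneg _) h1 2
    _ ≤ 2 * (W * ‖g (x + t) - g x‖) ^ 2 + 2 * (‖w (x + t) - w x‖ * ‖g x‖) ^ 2 := by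
        nlinarith [sq_nonneg (W * ‖g (x + t) - g x‖ - ‖w (x + t) - w x‖ * ‖g x‖)]
    _ = 2 * W ^ 2 * ‖g (x + t) - g x‖ ^ 2 + 2 * ‖w (x + t) - w x‖ ^ 2 * ‖g x‖ ^ 2 := by ring

/-- A bounded function has bounded increments: `‖w(x+t) − w(x)‖² ≤ 4 W²` if `‖w‖ ≤ W`. [folklore] -/
theorem dirichletMul_norm_sub_sq_le_four {w : ℝ → ℂ} {W : ℝ} (hW : ∀ x, ‖w x‖ ≤ W) (x t : ℝ) :
    ‖w (x + t) - w x‖ ^ 2 ≤ 4 * W ^ 2 := by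
  have h2 : ‖w (x + t) - w x‖ ≤ 2 * W := by
    calc ‖w (x + t) - w x‖ ≤ ‖w (x + t)‖ + ‖w x‖ := norm_sub_le _ _
      _ ≤ W + W := add_le_add (hW _) (hW _)
      _ = 2 * W := by ring
  calc ‖w (x + t) - w x‖ ^ 2 ≤ (2 * W) ^ 2 := pow_le_pow_left₀ (norm_nonneg _) h2 2
    _ = 4 * W ^ 2 := by ring

/-- Increments of a bounded Lipschitz function: if `‖w‖ ≤ W` and `‖w'‖ ≤ L` then for `t ≥ 0`
`‖w(x+t) − w(x)‖² ≤ (L t) (2 W) ≤ (W² + L²) t` (mean value inequality and `2 L W ≤ W² + L²`).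
[folklore] -/
theorem dirichletMul_norm_sub_sq_le_mul {w : ℝ → ℂ} (hw : Differentiable ℝ w) {W L t : ℝ}
    (hW : ∀ x, ‖w x‖ ≤ W) (hL : ∀ x, ‖deriv w x‖ ≤ L) (ht : 0 ≤ t) (x : ℝ) :
    ‖w (x + t) - w x‖ ^ 2 ≤ (W ^ 2 + L ^ 2) * t := by
  have hW0 : 0 ≤ W := (norm_nonneg _).trans (hW 0)
  have h1 : ‖w (x + t) - w x‖ ≤ L * t := by
    have h := (convex_univ (𝕜 := ℝ) (E := ℝ)).norm_image_sub_le_of_norm_deriv_le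
      (fun y _ ↦ hw y) (fun y _ ↦ hL y) (mem_univ x) (mem_univ (x + t))
    simpa [Real.norm_eq_abs, abs_of_nonneg ht] using h
  have h2 : ‖w (x + t) - w x‖ ≤ 2 * W := by
    calc ‖w (x + t) - w x‖ ≤ ‖w (x + t)‖ + ‖w x‖ := norm_sub_le _ _
      _ ≤ W + W := add_le_add (hW _) (hW _)
      _ = 2 * W := by ring
  have h3 : ‖w (x + t) - w x‖ ^ 2 ≤ (L * t) * (2 * W) := by
    rw [sq]
    exact mul_le_mul h1 h2 (norm_nonneg _) ((norm_nonneg _).trans h1)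
  nlinarith [mul_nonneg (sq_nonneg (L - W)) ht, h3]

/-! ## Increments of a product -/

/-- **Increments of a product.** If `‖w‖ ≤ W` and `‖w(x+t) − w(x)‖² ≤ B` for all `x`, then for
`g ∈ L²`, `D_t(w g) ≤ 2 W² D_t(g) + 2 B ‖g‖₂²` (`D_t = weilIncrement · t`). [folklore] -/
theorem dirichletMul_weilIncrement_le {w g : ℝ → ℂ} (hg : MemLp g 2 volume) {W B t : ℝ}
    (hW : ∀ x, ‖w x‖ ≤ W) (hB : ∀ x, ‖w (x + t) - w x‖ ^ 2 ≤ B) :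
    weilIncrement (fun x ↦ w x * g x) t ≤
      2 * W ^ 2 * weilIncrement g t + 2 * B * ∫ x : ℝ, ‖g x‖ ^ 2 := by
  have hi1 : Integrable fun x : ℝ ↦ ‖g (x + t) - g x‖ ^ 2 := integrable_weilIncrement_integrand hg t
  have hi2 : Integrable fun x : ℝ ↦ ‖g x‖ ^ 2 := (memLp_two_iff_integrable_sq_norm hg.1).1 hg
  have hint : Integrable fun x : ℝ ↦ 2 * W ^ 2 * ‖g (x + t) - g x‖ ^ 2 + 2 * B * ‖g x‖ ^ 2 :=
    (hi1.const_mul _).add (hi2.const_mul _)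
  calc weilIncrement (fun x ↦ w x * g x) t
      ≤ ∫ x : ℝ, (2 * W ^ 2 * ‖g (x + t) - g x‖ ^ 2 + 2 * B * ‖g x‖ ^ 2) := by
        unfold weilIncrement
        refine integral_mono_of_nonneg (Eventually.of_forall fun x ↦ by positivity) hint
          (Eventually.of_forall fun x ↦ ?_)
        calc ‖w (x + t) * g (x + t) - w x * g x‖ ^ 2
            ≤ 2 * W ^ 2 * ‖g (x + t) - g x‖ ^ 2 + 2 * ‖w (x + t) - w x‖ ^ 2 * ‖g x‖ ^ 2 :=
              dirichletMul_norm_sub_sq_le hW x t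
          _ ≤ 2 * W ^ 2 * ‖g (x + t) - g x‖ ^ 2 + 2 * B * ‖g x‖ ^ 2 := by
              gcongr
              exact hB x
    _ = 2 * W ^ 2 * weilIncrement g t + 2 * B * ∫ x : ℝ, ‖g x‖ ^ 2 := by
        unfold weilIncrement
        rw [integral_add (hi1.const_mul _) (hi2.const_mul _), integral_const_mul,
          integral_const_mul]

/-! ## The first moment of the archimedean density -/

/-- `t e^{t/2}/(2 sinh t) ≤ 4 e^{-t/4}` for `t > 0`
(`4 e^{-t/4} · 2 sinh t = 4 e^{3t/4} − 4 e^{-5t/4} ≥ 4 e^{t/2}(1 + t/4) − 4 e^{t/2}`). [folklore] -/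
theorem dirichletMul_weilArchDensity_mul_self_le {t : ℝ} (ht : 0 < t) :
    weilArchDensity t * t ≤ 4 * Real.exp (-(1 / 4) * t) := by
  have h2s : 0 < 2 * Real.sinh t := mul_pos two_pos (Real.sinh_pos_iff.2 ht)
  unfold weilArchDensity
  rw [div_mul_eq_mul_div, div_le_iff₀ h2s]
  have e1 : Real.exp (-(1 / 4) * t) * Real.exp t = Real.exp (3 / 4 * t) := by
    rw [← Real.exp_add]; congr 1; ring
  have e2 : Real.exp (-(1 / 4) * t) * Real.exp (-t) = Real.exp (-(5 / 4) * t) := by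
    rw [← Real.exp_add]; congr 1; ring
  have e3 : Real.exp (3 / 4 * t) = Real.exp (t / 2) * Real.exp (t / 4) := by
    rw [← Real.exp_add]; congr 1; ring
  have h4 : Real.exp (t / 2) * (t / 4 + 1) ≤ Real.exp (3 / 4 * t) := by
    rw [e3]
    exact mul_le_mul_of_nonneg_left (Real.add_one_le_exp _) (Real.exp_pos _).le
  have h5 : Real.exp (-(5 / 4) * t) ≤ Real.exp (t / 2) := Real.exp_le_exp.2 (by linarith)
  calc Real.exp (t / 2) * t
      = 4 * (Real.exp (t / 2) * (t / 4 + 1)) - 4 * Real.exp (t / 2) := by ring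
    _ ≤ 4 * Real.exp (3 / 4 * t) - 4 * Real.exp (-(5 / 4) * t) := by linarith
    _ = 4 * Real.exp (-(1 / 4) * t) * (2 * Real.sinh t) := by
        rw [Real.sinh_eq, ← e1, ← e2]; ring

/-- The first moment of the archimedean jump density converges:
`t ↦ t e^{t/2}/(2 sinh t)` is integrable on `(0, ∞)` (it is `≤ 4 e^{-t/4}`). [folklore] -/
theorem dirichletMul_integrableOn_weilArchDensity_mul_self :
    IntegrableOn (fun t : ℝ ↦ weilArchDensity t * t) (Ioi 0) := by
  refine Integrable.mono'
    ((exp_neg_integrableOn_Ioi 0 (by norm_num : (0 : ℝ) < 1 / 4)).const_mul 4) ?_ ?_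
  · unfold weilArchDensity
    exact ((((by fun_prop : Continuous fun t : ℝ ↦ Real.exp (t / 2)).measurable.div
      (by fun_prop : Continuous fun t : ℝ ↦ 2 * Real.sinh t).measurable).mul
        measurable_id).aestronglyMeasurable)
  · refine (ae_restrict_iff' measurableSet_Ioi).2 (Eventually.of_forall fun t (ht : 0 < t) ↦ ?_)
    rw [Real.norm_of_nonneg (mul_nonneg (weilArchDensity_pos ht).le ht.le)]
    exact dirichletMul_weilArchDensity_mul_self_le ht

/-! ## The multiplier bound -/

/-- **Stub `stub_dirichletEnergy_mul`** (W8 — bounded multipliers on the window's pure-jump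
Dirichlet form). For every `a > 0` there is `K ≥ 0` (namely
`K = 8 Σ_{n ∈ weilPrimeIndex a} Λ(n)/√n + 2 ∫₀^∞ t e^{t/2}/(2 sinh t) dt`) such that for test
functions `w`, `g` with `‖w‖ ≤ W`, `‖w'‖ ≤ L`,
`𝓔_a(w g) ≤ 2 W² 𝓔_a(g) + K (W² + L²) ‖g‖₂²`. [folklore] -/
theorem stub_dirichletEnergy_mul :
    ∀ a : ℝ, 0 < a → ∃ K : ℝ, 0 ≤ K ∧ ∀ (w g : ℝ → ℂ) (W L : ℝ), IsWeilTest w → IsWeilTest g →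
      tsupport g ⊆ Icc (-a) a → (∀ t, ‖w t‖ ≤ W) → (∀ t, ‖deriv w t‖ ≤ L) →
        weilDirichletEnergy a (fun t => w t * g t) ≤
          2 * W ^ 2 * weilDirichletEnergy a g + K * (W ^ 2 + L ^ 2) * ∫ t : ℝ, ‖g t‖ ^ 2 := by
  intro a _
  set S : ℝ := ∑ n ∈ weilPrimeIndex a, (Λ n : ℝ) / Real.sqrt n with hS
  set A : ℝ := ∫ t in Ioi (0 : ℝ), weilArchDensity t * t with hA
  have hS0 : 0 ≤ S := Finset.sum_nonneg fun n _ ↦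
    div_nonneg ArithmeticFunction.vonMangoldt_nonneg (Real.sqrt_nonneg _)
  have hA0 : 0 ≤ A := setIntegral_nonneg measurableSet_Ioi fun t ht ↦
    mul_nonneg (weilArchDensity_pos ht).le (le_of_lt ht)
  refine ⟨8 * S + 2 * A, by positivity, ?_⟩
  intro w g W L hw hg _hsupp hW hL
  have hwd : Differentiable ℝ w := hw.1.differentiable (by simp)
  have hwg : IsWeilTest (fun t ↦ w t * g t) := ⟨hw.1.mul hg.1, hg.2.mul_left⟩
  have hg2 : MemLp g 2 volume := hg.memLp_two
  set N : ℝ := ∫ t : ℝ, ‖g t‖ ^ 2 with hN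
  have hN0 : 0 ≤ N := integral_nonneg fun _ ↦ by positivity
  -- increment bounds: uniform in `t`, and linear in `t ≥ 0`
  have hunif : ∀ t : ℝ, weilIncrement (fun x ↦ w x * g x) t ≤
      2 * W ^ 2 * weilIncrement g t + 2 * (4 * W ^ 2) * N := fun t ↦
    dirichletMul_weilIncrement_le hg2 hW fun x ↦ dirichletMul_norm_sub_sq_le_four hW x t
  have hlin : ∀ t : ℝ, 0 ≤ t → weilIncrement (fun x ↦ w x * g x) t ≤
      2 * W ^ 2 * weilIncrement g t + 2 * ((W ^ 2 + L ^ 2) * t) * N := fun t ht ↦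
    dirichletMul_weilIncrement_le hg2 hW fun x ↦ dirichletMul_norm_sub_sq_le_mul hwd hW hL ht x
  -- the prime part
  have hprime : ∑ n ∈ weilPrimeIndex a, (Λ n : ℝ) / Real.sqrt n *
      weilIncrement (fun x ↦ w x * g x) (Real.log n) ≤
      2 * W ^ 2 * (∑ n ∈ weilPrimeIndex a, (Λ n : ℝ) / Real.sqrt n *
        weilIncrement g (Real.log n)) + 8 * W ^ 2 * N * S := by
    calc ∑ n ∈ weilPrimeIndex a, (Λ n : ℝ) / Real.sqrt n *
          weilIncrement (fun x ↦ w x * g x) (Real.log n)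
        ≤ ∑ n ∈ weilPrimeIndex a, (Λ n : ℝ) / Real.sqrt n *
          (2 * W ^ 2 * weilIncrement g (Real.log n) + 2 * (4 * W ^ 2) * N) :=
          Finset.sum_le_sum fun n _ ↦ mul_le_mul_of_nonneg_left (hunif _)
            (div_nonneg ArithmeticFunction.vonMangoldt_nonneg (Real.sqrt_nonneg _))
      _ = 2 * W ^ 2 * (∑ n ∈ weilPrimeIndex a, (Λ n : ℝ) / Real.sqrt n *
            weilIncrement g (Real.log n)) + 8 * W ^ 2 * N * S := by
          rw [hS, Finset.mul_sum, Finset.mul_sum, ← Finset.sum_add_distrib]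
          exact Finset.sum_congr rfl fun n _ ↦ by ring
  -- the archimedean part
  have harch : ∫ t in Ioi (0 : ℝ), weilArchDensity t * weilIncrement (fun x ↦ w x * g x) t ≤
      2 * W ^ 2 * (∫ t in Ioi (0 : ℝ), weilArchDensity t * weilIncrement g t) +
        2 * (W ^ 2 + L ^ 2) * N * A := by
    have hi1 := integrableOn_weilArchDensity_mul_weilIncrement hg
    have hi2 := dirichletMul_integrableOn_weilArchDensity_mul_self
    have hint : IntegrableOn (fun t : ℝ ↦ 2 * W ^ 2 * (weilArchDensity t * weilIncrement g t) +
        2 * (W ^ 2 + L ^ 2) * N * (weilArchDensity t * t)) (Ioi 0) :=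
      (hi1.const_mul _).add (hi2.const_mul _)
    calc ∫ t in Ioi (0 : ℝ), weilArchDensity t * weilIncrement (fun x ↦ w x * g x) t
        ≤ ∫ t in Ioi (0 : ℝ), (2 * W ^ 2 * (weilArchDensity t * weilIncrement g t) +
            2 * (W ^ 2 + L ^ 2) * N * (weilArchDensity t * t)) := by
          refine setIntegral_mono_on (integrableOn_weilArchDensity_mul_weilIncrement hwg) hint
            measurableSet_Ioi fun t (ht : 0 < t) ↦ ?_
          calc weilArchDensity t * weilIncrement (fun x ↦ w x * g x) t
              ≤ weilArchDensity t *
                  (2 * W ^ 2 * weilIncrement g t + 2 * ((W ^ 2 + L ^ 2) * t) * N) :=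
                mul_le_mul_of_nonneg_left (hlin t ht.le) (weilArchDensity_pos ht).le
            _ = _ := by ring
      _ = 2 * W ^ 2 * (∫ t in Ioi (0 : ℝ), weilArchDensity t * weilIncrement g t) +
            2 * (W ^ 2 + L ^ 2) * N * A := by
          rw [hA, integral_add (hi1.const_mul _) (hi2.const_mul _), integral_const_mul,
            integral_const_mul]
  -- assemble
  have key : 8 * W ^ 2 * N * S + 2 * (W ^ 2 + L ^ 2) * N * A ≤
      (8 * S + 2 * A) * (W ^ 2 + L ^ 2) * N := by
    have h0 : 0 ≤ S * L ^ 2 * N := by positivity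
    nlinarith [h0]
  unfold weilDirichletEnergy
  linarith [hprime, harch, key]

end Summit.RiemannHypothesis.RiemannHypothesis.Theorems.GroundStatesConvergeToXi

end
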